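import Summits.RiemannHypothesis.RiemannHypothesis.Theorems.WeilFormatCDataRungGenericA
import Summits.RiemannHypothesis.RiemannHypothesis.Theorems.WeilFormatCDataRungPieces
import HarnessLib

/-!
# Format C: the data front door with a COMPRESSED MIDDLE and the certified PRIME constant `A` (design "MJ" under the A-door)

Route context: Fourier–Galerkin / Schur-complement certificates of Weil positivity on a window ("format C";
cell memo `run/shared/lean/pub/rh-explicit/rh-explicit-weil-10/FORMATC-DESIGN.md` §9.10.5; supporting
stmt-RiemannHypothesis-0098; seat rh-explicit-weil-10; lead rulings R8-28 / R8-32).  This is `WeilFormatC.weilPositivityOn_of_formatC_piecesA`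
= `weilPositivityOn_of_formatC_kernelsA` (weil-1, p338424: the far diagonals carry a certified prime constant `A/2`, hypothesis
`hPA`, instead of the path-graph cosine sum) with the additional abstract MIDDLE piece per sector of
`weilPositivityOn_of_formatC_pieces` (p338810): exact columns `[B, B₃)`, a middle range `[B₃, B₄)` with per-mode weights and
an arbitrary matrix `U_mid` certified by `hUmid` (the conclusion shape of `even/odd_middleJ_majorant_matrix`), the tail from
`B₄`, and the kernel PSD check against `M − U₁ − U_mid − U₂`.

* `weilPositivityOn_of_formatC_piecesA`.

Standard axioms; no definitions; no RH claim (a rung `WeilPositivityOn a` is one case of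
`riemannHypothesis_iff_forall_weilPositivityOn`).
-/

set_option autoImplicit false
-- `Summit.RiemannHypothesis.RiemannHypothesis.…` is the layout-mandated namespace (summit = problem name).
set_option linter.dupNamespace false

noncomputable section

open Complex Finset Matrix
open scoped Real BigOperators ComplexConjugate ArithmeticFunction.vonMangoldt

namespace Summit.RiemannHypothesis.RiemannHypothesis.Theorems.WeilFormatC

open Literature.NumberTheory.LFunctions Literature.NumberTheory.LFunctions.Yoshida1992
open Literature.Analysis.SpecialFunctions

variable {a : ℝ}

/-! ## The data-only rung theorem -/

section Rung

/-- **Format C, data front door with a compressed middle under the certified prime constant `A`.**  See the module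
docstring: `hPA` is the prime-form lower bound `−A·Σ‖c‖² ≤ ΣΣ Re(c̄_n c_m)·primeCoeff a n m`; per sector exact columns on `[B, B₃)`,
an arbitrary middle matrix on `[B₃, B₄)` with per-mode weights, an arbitrary tail matrix from `B₄`, and the kernel PSD check. -/
theorem weilPositivityOn_of_formatC_piecesA (ha : 0 < a)
    -- the certified PRIME constant of the window (`primeCoeff_form_ge_cells_*`, or `A_op⁺` via `primeCoeff_form_ge`)
    {A : ℝ} (hPA : ∀ (s : Finset ℤ) (c : ℤ → ℂ),
      -(A * ∑ n ∈ s, ‖c n‖ ^ 2) ≤ ∑ n ∈ s, ∑ m ∈ s, (conj (c n) * c m).re * primeCoeff a n m)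
    -- EVEN sector data
    {Be B3e B4e : ℕ} (hBe : 2 ≤ Be) (hBBe : Be ≤ B3e) (hB34e : B3e ≤ B4e) {d0e : ℝ}
    (we wme : ℕ → ℝ)
    (h0e : 0 < ((reDigammaQuarter (freq a Be) - Real.log π) / 2 - a * (1 + weilArchDensity (2 * a)) / (π ^ 2 * Be ^ 2) - 1 / (8 * Be) - a * (1 + weilArchDensity (2 * a)) / π ^ 2 * Real.sqrt (8 / ((Be - 1 : ℕ) : ℝ)) - A / 2))
    (hd0e : 0 < d0e ∧ d0e ≤ ((reDigammaQuarter (freq a B4e) - Real.log π) / 2 - a * (1 + weilArchDensity (2 * a)) / (π ^ 2 * B4e ^ 2) - 1 / (8 * B4e) - a * (1 + weilArchDensity (2 * a)) / π ^ 2 * Real.sqrt (8 / ((Be - 1 : ℕ) : ℝ)) - A / 2))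
    (hwe : ∀ m, Be ≤ m → m < B3e → 0 < we m ∧ we m ≤ ((reDigammaQuarter (freq a m) - Real.log π) / 2 - a * (1 + weilArchDensity (2 * a)) / (π ^ 2 * m ^ 2) - 1 / (8 * m) - a * (1 + weilArchDensity (2 * a)) / π ^ 2 * Real.sqrt (8 / ((Be - 1 : ℕ) : ℝ)) - A / 2))
    (hwme : ∀ m, B3e ≤ m → m < B4e → 0 < wme m ∧ wme m ≤ ((reDigammaQuarter (freq a m) - Real.log π) / 2 - a * (1 + weilArchDensity (2 * a)) / (π ^ 2 * m ^ 2) - 1 / (8 * m) - a * (1 + weilArchDensity (2 * a)) / π ^ 2 * Real.sqrt (8 / ((Be - 1 : ℕ) : ℝ)) - A / 2))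
    (Umide : Matrix (Fin Be) (Fin Be) ℝ)
    (hUmide : ∀ d : ℕ → ℝ, (∀ m, B3e ≤ m → m < B4e → 0 < wme m ∧ wme m ≤ d m) → ∀ x : Fin Be → ℝ,
      ∑ m ∈ Finset.Ico B3e B4e, (∑ i : Fin Be, (if (i : ℕ) = 0 then gramCoeff a 0 m else if m = 0 then gramCoeff a i 0 else (gramCoeff a i m + gramCoeff a i (-(m : ℤ))) / 2) * x i) ^ 2 / d m
        ≤ x ⬝ᵥ Umide *ᵥ x)
    (U2e : Matrix (Fin Be) (Fin Be) ℝ)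
    (hU2e : ∀ d : ℕ → ℝ, (∀ m, B4e ≤ m → d0e ≤ d m) → ∀ (N : ℕ) (x : Fin Be → ℝ),
      ∑ m ∈ Finset.Ico B4e N, (∑ i : Fin Be, (if (i : ℕ) = 0 then gramCoeff a 0 m else if m = 0 then gramCoeff a i 0 else (gramCoeff a i m + gramCoeff a i (-(m : ℤ))) / 2) * x i) ^ 2 / d m
        ≤ x ⬝ᵥ U2e *ᵥ x)
    (hSe : ∀ x : Fin Be → ℝ, 0 ≤ ∑ i, ∑ i', x i * x i' *
      ((if (i : ℕ) = 0 then gramCoeff a 0 i' else if (i' : ℕ) = 0 then gramCoeff a i 0 else (gramCoeff a i i' + gramCoeff a i (-(i' : ℤ))) / 2)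
        - (∑ m ∈ Finset.Ico Be B3e, (if (i : ℕ) = 0 then gramCoeff a 0 m else if m = 0 then gramCoeff a i 0 else (gramCoeff a i m + gramCoeff a i (-(m : ℤ))) / 2) * (if (i' : ℕ) = 0 then gramCoeff a 0 m else if m = 0 then gramCoeff a i' 0 else (gramCoeff a i' m + gramCoeff a i' (-(m : ℤ))) / 2) / we m)
        - Umide i i' - U2e i i'))
    -- ODD sector data
    {Bo B3o B4o : ℕ} (hBo : 1 ≤ Bo) (hBBo : Bo ≤ B3o) (hB34o : B3o ≤ B4o) {d0o : ℝ}
    (wo wmo : ℕ → ℝ)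
    (h0o : 0 < ((reDigammaQuarter (freq a ((Bo : ℤ) + 1)) - Real.log π) / 2 - 1 / (8 * ((Bo : ℝ) + 1)) - a * (1 + weilArchDensity (2 * a)) / (π ^ 2 * ((Bo : ℝ) + 1) ^ 2)) - π / 4 - a * (1 + weilArchDensity (2 * a)) / π ^ 2 * Real.sqrt (8 / Bo) - A / 2 - (Real.exp (a / 2) - Real.exp (-(a / 2))) ^ 2 * a / (π ^ 2 * Bo))
    (hd0o : 0 < d0o ∧ d0o ≤ ((reDigammaQuarter (freq a ((B4o : ℤ) + 1)) - Real.log π) / 2 - 1 / (8 * ((B4o : ℝ) + 1)) - a * (1 + weilArchDensity (2 * a)) / (π ^ 2 * ((B4o : ℝ) + 1) ^ 2)) - π / 4 - a * (1 + weilArchDensity (2 * a)) / π ^ 2 * Real.sqrt (8 / Bo) - A / 2 - (Real.exp (a / 2) - Real.exp (-(a / 2))) ^ 2 * a / (π ^ 2 * Bo))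
    (hwo : ∀ l, Bo ≤ l → l < B3o → 0 < wo l ∧ wo l ≤ ((reDigammaQuarter (freq a ((l : ℤ) + 1)) - Real.log π) / 2 - 1 / (8 * ((l : ℝ) + 1)) - a * (1 + weilArchDensity (2 * a)) / (π ^ 2 * ((l : ℝ) + 1) ^ 2) - (π / 2 - Real.arctan (Real.sqrt Bo / Real.sqrt ((l : ℝ) + 1))) / 2 - a * (1 + weilArchDensity (2 * a)) / π ^ 2 * Real.sqrt (8 / Bo) - A / 2 - (Real.exp (a / 2) - Real.exp (-(a / 2))) ^ 2 * a / (π ^ 2 * Bo)))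
    (hwmo : ∀ l, B3o ≤ l → l < B4o → 0 < wmo l ∧ wmo l ≤ ((reDigammaQuarter (freq a ((l : ℤ) + 1)) - Real.log π) / 2 - 1 / (8 * ((l : ℝ) + 1)) - a * (1 + weilArchDensity (2 * a)) / (π ^ 2 * ((l : ℝ) + 1) ^ 2) - (π / 2 - Real.arctan (Real.sqrt Bo / Real.sqrt ((l : ℝ) + 1))) / 2 - a * (1 + weilArchDensity (2 * a)) / π ^ 2 * Real.sqrt (8 / Bo) - A / 2 - (Real.exp (a / 2) - Real.exp (-(a / 2))) ^ 2 * a / (π ^ 2 * Bo)))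
    (Umido : Matrix (Fin Bo) (Fin Bo) ℝ)
    (hUmido : ∀ d : ℕ → ℝ, (∀ l, B3o ≤ l → l < B4o → 0 < wmo l ∧ wmo l ≤ d l) → ∀ x : Fin Bo → ℝ,
      ∑ l ∈ Finset.Ico B3o B4o, (∑ k : Fin Bo, ((gramCoeff a (((k : ℕ) : ℤ) + 1) ((l : ℤ) + 1) - gramCoeff a (((k : ℕ) : ℤ) + 1) (-((l : ℤ) + 1))) / 2) * x k) ^ 2 / d l
        ≤ x ⬝ᵥ Umido *ᵥ x)
    (U2o : Matrix (Fin Bo) (Fin Bo) ℝ)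
    (hU2o : ∀ d : ℕ → ℝ, (∀ l, B4o ≤ l → d0o ≤ d l) → ∀ (N : ℕ) (x : Fin Bo → ℝ),
      ∑ l ∈ Finset.Ico B4o N, (∑ k : Fin Bo, ((gramCoeff a (((k : ℕ) : ℤ) + 1) ((l : ℤ) + 1) - gramCoeff a (((k : ℕ) : ℤ) + 1) (-((l : ℤ) + 1))) / 2) * x k) ^ 2 / d l
        ≤ x ⬝ᵥ U2o *ᵥ x)
    (hSo : ∀ x : Fin Bo → ℝ, 0 ≤ ∑ k, ∑ k', x k * x k' *
      (((gramCoeff a (((k : ℕ) : ℤ) + 1) (((k' : ℕ) : ℤ) + 1) - gramCoeff a (((k : ℕ) : ℤ) + 1) (-(((k' : ℕ) : ℤ) + 1))) / 2)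
        - (∑ l ∈ Finset.Ico Bo B3o, ((gramCoeff a (((k : ℕ) : ℤ) + 1) ((l : ℤ) + 1) - gramCoeff a (((k : ℕ) : ℤ) + 1) (-((l : ℤ) + 1))) / 2) * ((gramCoeff a (((k' : ℕ) : ℤ) + 1) ((l : ℤ) + 1) - gramCoeff a (((k' : ℕ) : ℤ) + 1) (-((l : ℤ) + 1))) / 2) / wo l)
        - Umido k k' - U2o k k')) :
    WeilPositivityOn a := by
  have hE0 : 0 < weilArchDensity (2 * a) := weilArchDensity_pos (by positivity)
  have hC : 0 ≤ a * (1 + weilArchDensity (2 * a)) := by positivity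
  -- the sector kernels and far diagonals as functions
  set Mev : ℕ → ℕ → ℝ := fun i j ↦ (if i = 0 then gramCoeff a 0 j else if j = 0 then gramCoeff a i 0 else (gramCoeff a i j + gramCoeff a i (-(j : ℤ))) / 2) with hMev
  set Mod : ℕ → ℕ → ℝ := fun k l ↦ ((gramCoeff a ((k : ℤ) + 1) ((l : ℤ) + 1) - gramCoeff a ((k : ℤ) + 1) (-((l : ℤ) + 1))) / 2) with hMod
  set dev : ℕ → ℝ := fun m ↦ ((reDigammaQuarter (freq a m) - Real.log π) / 2 - a * (1 + weilArchDensity (2 * a)) / (π ^ 2 * m ^ 2) - 1 / (8 * m) - a * (1 + weilArchDensity (2 * a)) / π ^ 2 * Real.sqrt (8 / ((Be - 1 : ℕ) : ℝ)) - A / 2) with hdev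
  set dod : ℕ → ℝ := fun l ↦ ((reDigammaQuarter (freq a ((l : ℤ) + 1)) - Real.log π) / 2 - 1 / (8 * ((l : ℝ) + 1)) - a * (1 + weilArchDensity (2 * a)) / (π ^ 2 * ((l : ℝ) + 1) ^ 2) - (π / 2 - Real.arctan (Real.sqrt Bo / Real.sqrt ((l : ℝ) + 1))) / 2 - a * (1 + weilArchDensity (2 * a)) / π ^ 2 * Real.sqrt (8 / Bo) - A / 2 - (Real.exp (a / 2) - Real.exp (-(a / 2))) ^ 2 * a / (π ^ 2 * Bo)) with hdod
  refine weilPositivityOn_of_sector_kernels_nonneg ha (gramCoeff a) (weilWindowSesq_chi ha) (gramCoeff_neg_neg a)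
    ?_ ?_
  · -- EVEN sector
    intro K y
    have hB3e1 : 1 ≤ B3e := by omega
    have hd : ∀ m, Be ≤ m → 0 < dev m := fun m hm ↦ by
      simp only [hdev]
      have h := even_dhat_core_mono ha hC (le_trans (by norm_num) hBe) hm
      linarith [h0e]
    have hB4e1 : 1 ≤ B4e := by omega
    have hdmono : ∀ m, B4e ≤ m → d0e ≤ dev m := fun m hm ↦ by
      simp only [hdev]
      have h := even_dhat_core_mono ha hC hB4e1 hm
      linarith [hd0e.2]
    have hfar : ∀ (N : ℕ) (y : ℕ → ℝ),
        ∑ n ∈ Finset.Ico Be N, dev n * y n ^ 2 ≤ ∑ n ∈ Finset.Ico Be N, ∑ m ∈ Finset.Ico Be N, y n * Mev n m * y m :=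
      fun N y ↦ by
        simp only [hdev, hMev]
        exact gramCoeff_even_far_ge_diag_A ha hPA hBe N y
    have hU1 : ∀ x : Fin Be → ℝ,
        ∑ m ∈ Finset.Ico Be B3e, (∑ i : Fin Be, Mev i m * x i) ^ 2 / dev m
          ≤ x ⬝ᵥ (Matrix.of fun i j : Fin Be ↦ ∑ m ∈ Finset.Ico Be B3e, Mev i m * Mev j m / we m) *ᵥ x :=
      fun x ↦ columns_majorant (Finset.Ico Be B3e) (fun m i ↦ Mev i m) dev we
        (fun m hm ↦ by
          have hm := Finset.mem_Ico.mp hm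
          have h := hwe m hm.1 hm.2
          simp only [hdev]
          exact h) x
    have hmid : ∀ x : Fin Be → ℝ,
        ∑ m ∈ Finset.Ico B3e B4e, (∑ i : Fin Be, Mev i m * x i) ^ 2 / dev m ≤ x ⬝ᵥ Umide *ᵥ x := fun x ↦ by
      have h := hUmide dev (fun m hm hm' ↦ by
        have h := hwme m hm hm'
        simp only [hdev]
        exact h) x
      simp only [hMev, hdev] at h ⊢
      exact h
    have htail : ∀ (N : ℕ) (x : Fin Be → ℝ),
        ∑ m ∈ Finset.Ico B4e N, (∑ i : Fin Be, Mev i m * x i) ^ 2 / dev m ≤ x ⬝ᵥ U2e *ᵥ x := fun N x ↦ by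
      have h := hU2e dev hdmono N x
      simp only [hMev, hdev] at h ⊢
      exact h
    have hU2 : ∀ (N : ℕ) (x : Fin Be → ℝ),
        ∑ m ∈ Finset.Ico B3e N, (∑ i : Fin Be, Mev i m * x i) ^ 2 / dev m ≤ x ⬝ᵥ (Umide + U2e) *ᵥ x := by
      intro N x
      have hnn : ∀ m, B3e ≤ m → 0 ≤ (∑ i : Fin Be, Mev i m * x i) ^ 2 / dev m := fun m hm ↦
        div_nonneg (sq_nonneg _) (hd m (by omega)).le
      rw [Matrix.add_mulVec, dotProduct_add]
      refine le_trans ?_ (add_le_add (hmid x) (htail N x))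
      exact sum_Ico_le_sum_Ico_add_sum_Ico hB34e hnn
    have key := sum_range_mul_mul_nonneg_of_certificate_sum_split Mev
      (fun n m ↦ evenKernel_symm (gramCoeff a) (gramCoeff_comm a) (gramCoeff_neg_neg a) n m)
      Be B3e hBBe dev _ _ hd hfar hU1 hU2 (fun x ↦ by
        refine (hSe x).trans_eq (Finset.sum_congr rfl fun i _ ↦ Finset.sum_congr rfl fun i' _ ↦ ?_)
        simp only [hMev, Matrix.of_apply, Matrix.add_apply]
        ring) K y
    simpa only [hMev] using key
  · -- ODD sector
    intro K z
    have hB3o : 1 ≤ B3o := by omega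
    have hd : ∀ l, Bo ≤ l → 0 < dod l := fun l hl ↦ by
      simp only [hdod]
      have h := odd_dhat_core_mono ha hC hl
      have hpen := hilbert_atan_penalty_le Bo l
      linarith [h0o]
    have hdlow : ∀ l, B4o ≤ l → d0o ≤ dod l := fun l hl ↦ by
      simp only [hdod]
      have h := odd_dhat_core_mono ha hC hl
      have hpen := hilbert_atan_penalty_le Bo l
      linarith [hd0o.2]
    have hfar : ∀ (N : ℕ) (z : ℕ → ℝ),
        ∑ k ∈ Finset.Ico Bo N, dod k * z k ^ 2 ≤ ∑ k ∈ Finset.Ico Bo N, ∑ l ∈ Finset.Ico Bo N, z k * Mod k l * z l :=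
      fun N z ↦ by
        simp only [hdod, hMod]
        exact gramCoeff_odd_far_ge_diag_atan_A ha hPA hBo N z
    have hU1 : ∀ x : Fin Bo → ℝ,
        ∑ l ∈ Finset.Ico Bo B3o, (∑ k : Fin Bo, Mod k l * x k) ^ 2 / dod l
          ≤ x ⬝ᵥ (Matrix.of fun k k' : Fin Bo ↦ ∑ l ∈ Finset.Ico Bo B3o, Mod k l * Mod k' l / wo l) *ᵥ x :=
      fun x ↦ columns_majorant (Finset.Ico Bo B3o) (fun l k ↦ Mod k l) dod wo
        (fun l hl ↦ by
          have hl := Finset.mem_Ico.mp hl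
          have h := hwo l hl.1 hl.2
          simp only [hdod]
          exact h) x
    have hmid : ∀ x : Fin Bo → ℝ,
        ∑ l ∈ Finset.Ico B3o B4o, (∑ k : Fin Bo, Mod k l * x k) ^ 2 / dod l ≤ x ⬝ᵥ Umido *ᵥ x := fun x ↦ by
      have h := hUmido dod (fun l hl hl' ↦ by
        have h := hwmo l hl hl'
        simp only [hdod]
        exact h) x
      simp only [hMod, hdod] at h ⊢
      exact h
    have htail : ∀ (N : ℕ) (x : Fin Bo → ℝ),
        ∑ l ∈ Finset.Ico B4o N, (∑ k : Fin Bo, Mod k l * x k) ^ 2 / dod l ≤ x ⬝ᵥ U2o *ᵥ x := fun N x ↦ by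
      have h := hU2o dod hdlow N x
      simp only [hMod, hdod] at h ⊢
      exact h
    have hU2 : ∀ (N : ℕ) (x : Fin Bo → ℝ),
        ∑ l ∈ Finset.Ico B3o N, (∑ k : Fin Bo, Mod k l * x k) ^ 2 / dod l ≤ x ⬝ᵥ (Umido + U2o) *ᵥ x := by
      intro N x
      have hnn : ∀ l, B3o ≤ l → 0 ≤ (∑ k : Fin Bo, Mod k l * x k) ^ 2 / dod l := fun l hl ↦
        div_nonneg (sq_nonneg _) (hd l (by omega)).le
      rw [Matrix.add_mulVec, dotProduct_add]
      refine le_trans ?_ (add_le_add (hmid x) (htail N x))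
      exact sum_Ico_le_sum_Ico_add_sum_Ico hB34o hnn
    have key := sum_range_mul_mul_nonneg_of_certificate_sum_split Mod
      (fun k l ↦ oddKernel_symm (gramCoeff a) (gramCoeff_comm a) (gramCoeff_neg_neg a) k l)
      Bo B3o hBBo dod _ _ hd hfar hU1 hU2 (fun x ↦ by
        refine (hSo x).trans_eq (Finset.sum_congr rfl fun k _ ↦ Finset.sum_congr rfl fun k' _ ↦ ?_)
        simp only [hMod, Matrix.of_apply, Matrix.add_apply]
        ring) K z
    simpa only [hMod] using key

end Rung

end Summit.RiemannHypothesis.RiemannHypothesis.Theorems.WeilFormatC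

end
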